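import Summits.BirchSwinnertonDyer.BirchSwinnertonDyer.Theorems.CyclotomicUntwistPrimePowerGaussSum
import HarnessLib

/-!
# `U_p (f ⊗ η̄) = 0` in symbols: the untwisted symbol sums of D1 vanish on every fibre of
# `ℤ/p^{n+1} → ℤ/pⁿ` — the distribution relation behind the untwist's `p`-adic `L`-function

Cell `pub/bsd-wall` (D-0145 line `route-BirchSwinnertonDyer-CyclotomicUntwist`), seat `bsd-line-cycu-p1`
(prover seat 1/3, K1 base), helper toward crux K1 `PSRankOneLowerHalfAtThree`
(stmt-BirchSwinnertonDyer-21580). THEOREMS ONLY (no definition, no named fact, no `sorry`); BSD is not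
proved by this file and no crux is.

D1 (`Literature.NumberTheory.IwasawaTheory.PSCyclotomicLFunction`) explains that the untwist `g` of
`f ⊗ η̄` satisfies `g = h + α g(p·)` with `h = f ⊗ η̄` the coefficientwise twist, so that `U_p g = α g` is
EQUIVALENT to `U_p h = 0`; and `U_p h = 0` holds because `h` has no coefficients at multiples of `p`. In
the RATIONAL PLUS SYMBOLS of `f` (the only currency the tree has for `h`) the statement `U_p h = 0` reads:
for every `a ∈ ℤ/pⁿ⁺¹`-fibre over a point of `ℤ/pⁿ`,

  `∑_{j mod p} ∑_{b mod p^c} η(b) [ (a + pⁿ j)/p^{n+1} + b/p^c ]⁺_f = 0`      (U)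

for `η` PRIMITIVE mod `p^c` (`c ≥ 1`), ANY cusp form `f` on `Γ₀(N)` and any `n`. This file PROVES (U)
(`untwistedFibreSum_eq_zero`) by pure character algebra: `(a + pⁿj)/pⁿ⁺¹ + b/p^c = a/pⁿ⁺¹ + (b + p^{c−1}j)/p^c`,
so after `b ↦ b − p^{c−1}j` the `j`-sum becomes the sum of `η` over a coset of `p^{c−1}ℤ/p^c`, which
vanishes for a primitive `η` (`sum_fibre_eq_zero`: multiply by a unit `u ≡ 1 (p^{c−1})` with `η(u) ≠ 1`,
`PSPrimePowerGauss.exists_unitsMap_eq_one_apply_ne_one`; `u` permutes the coset). No modular input beyond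
`[r + 1]⁺ = [r]⁺` (`ratPlusSymbol_add_intCast_eq`). Together with the untwisting identity (★)
(`CyclotomicUntwistUntwistingIdentity`) and the Gauss-sum/non-vanishing file this is the f-symbol
toolkit a proof of the route's F1 (existence of `𝓛^η`, Mazur–Tate–Teitelbaum §I.14 / Kato Thm 16.2) would
start from; the remaining input of such a proof — bounded denominators of the UNTWISTED ball values
(Manin–Drinfeld for `g`) — is not an `f`-symbol identity and is not claimed here.

References: [cite: MazurTateTeitelbaum1986Invent, §I.4 (4.2) and §I.14 (case p ∣ N)];
[cite: Bellaiche2021, §6.7.2]; character sums over cosets [folklore].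
-/

noncomputable section

open scoped MatrixGroups

open CongruenceSubgroup DirichletCharacter Literature.NumberTheory.EllipticCurves
  Literature.NumberTheory.EllipticCurves.ModularForms Literature.NumberTheory.IwasawaTheory
  Summit.BirchSwinnertonDyer.BirchSwinnertonDyer.Theorems.PSUntwisting
  Summit.BirchSwinnertonDyer.BirchSwinnertonDyer.Theorems.PSPrimePowerGauss

-- single-conjunct summit: `Summit.BirchSwinnertonDyer.BirchSwinnertonDyer.…` repeats the name by design
set_option linter.dupNamespace false
set_option autoImplicit false

namespace Summit.BirchSwinnertonDyer.BirchSwinnertonDyer.Theorems.PSUntwistDistribution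

variable {p : ℕ} [Fact p.Prime]

/-! ### §1 A primitive character sums to zero over every coset of `p^{c−1}ℤ/p^c` -/

section Coset

variable {c : ℕ} (η : DirichletCharacter ℂ_[p] (p ^ c))

/-- `t · X` depends only on `X mod p` for `t = p^{c−1}` (`c ≥ 1`): the case `(n, c) = (c, 1)` of
`PSUntwisting.mul_eq_mul_of_castHom_eq`, restated with the reduction of a canonical lift. [folklore] -/
theorem pow_pred_mul_natCast_val (hc : 1 ≤ c) (X : ZMod (p ^ c)) :
    ((p ^ (c - 1) : ℕ) : ZMod (p ^ c)) * X =
      ((p ^ (c - 1) : ℕ) : ZMod (p ^ c)) *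
        (((ZMod.castHom (pow_dvd_pow p hc) (ZMod (p ^ 1)) X).val : ℕ) : ZMod (p ^ c)) := by
  refine mul_eq_mul_of_castHom_eq (p := p) (n := c) (c := 1) hc ?_
  rw [castHom_natCast_val (p := p) hc]

/-- **Coset sums of a primitive character vanish**: for `η` primitive mod `p^c` (`c ≥ 1`) and any `y`,
`∑_{j mod p} η(y + p^{c−1}·j) = 0`. For `c = 1` this is `∑_{x mod p} η(x) = 0` (`η ≠ 1`); for `c ≥ 2` the
coset `y + p^{c−1}ℤ/p^c` is permuted by a unit `u = 1 + p^{c−1}q` with `η(u) ≠ 1`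
(`PSPrimePowerGauss.exists_unitsMap_eq_one_apply_ne_one`; `u·p^{c−1} = p^{c−1}` as `p^{2c−2} = 0`).
[folklore] -/
theorem sum_coset_eq_zero (hc : 0 < c) (hη : η.IsPrimitive) (y : ZMod (p ^ c)) :
    ∑ j : ZMod (p ^ 1), η (y + ((p ^ (c - 1) : ℕ) : ZMod (p ^ c)) * ((j.val : ℕ) : ZMod (p ^ c))) = 0 := by
  haveI : NeZero (p ^ 1) := ⟨pow_ne_zero _ (Fact.out : p.Prime).ne_zero⟩
  haveI : NeZero (p ^ c) := ⟨pow_ne_zero _ (Fact.out : p.Prime).ne_zero⟩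
  have hp : p.Prime := Fact.out
  set t : ZMod (p ^ c) := ((p ^ (c - 1) : ℕ) : ZMod (p ^ c)) with ht
  rcases Nat.lt_or_ge c 2 with hc1 | hc2
  · -- `c = 1`: the sum is over all of `ℤ/p`
    have hc' : c = 1 := by omega
    subst hc'
    have ht1 : t = 1 := by rw [ht]; simp
    have hne : η ≠ 1 := by
      intro h1
      have hcond : η.conductor = p ^ 1 := hη
      rw [h1, conductor_one] at hcond
      exact absurd hcond (by rw [pow_one]; exact hp.one_lt.ne)
    calc ∑ j : ZMod (p ^ 1), η (y + t * ((j.val : ℕ) : ZMod (p ^ 1)))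
        = ∑ j : ZMod (p ^ 1), η (y + j) := by
          refine Finset.sum_congr rfl fun j _ ↦ ?_
          rw [ht1, one_mul, ZMod.natCast_zmod_val]
      _ = ∑ x : ZMod (p ^ 1), η x := Fintype.sum_equiv (Equiv.addLeft y) _ _ fun j ↦ rfl
      _ = 0 := η.sum_eq_zero_of_ne_one hne
  · -- `c ≥ 2`
    obtain ⟨u, hu, hηu⟩ := exists_unitsMap_eq_one_apply_ne_one η hc hη
    obtain ⟨q, hq⟩ := exists_eq_one_add_of_unitsMap_eq_one (Nat.sub_le c 1) hu
    have htt : t * t = 0 := by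
      rw [ht, ← Nat.cast_mul, ← pow_add, ZMod.natCast_eq_zero_iff]
      exact pow_dvd_pow p (by omega)
    have hut : (u : ZMod (p ^ c)) * t = t := by
      rw [hq]; linear_combination (q : ZMod (p ^ c)) * htt
    -- `u·y = y + t·k₀`
    set k₀ : ZMod (p ^ 1) := ZMod.castHom (pow_dvd_pow p hc) (ZMod (p ^ 1)) ((q : ZMod (p ^ c)) * y)
      with hk₀
    have huy : (u : ZMod (p ^ c)) * y = y + t * ((k₀.val : ℕ) : ZMod (p ^ c)) := by
      rw [hk₀, ← pow_pred_mul_natCast_val hc, hq]; ring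
    set S := ∑ j : ZMod (p ^ 1), η (y + t * ((j.val : ℕ) : ZMod (p ^ c))) with hS
    have hfix : η u * S = S := by
      rw [hS, Finset.mul_sum]
      calc ∑ j : ZMod (p ^ 1), η u * η (y + t * ((j.val : ℕ) : ZMod (p ^ c)))
          = ∑ j : ZMod (p ^ 1), η (y + t * (((k₀ + j).val : ℕ) : ZMod (p ^ c))) := by
            refine Finset.sum_congr rfl fun j _ ↦ ?_
            rw [← map_mul, mul_add, huy, ← mul_assoc, hut, add_assoc, ← mul_add]
            congr 2
            refine mul_eq_mul_of_castHom_eq (p := p) (n := c) (c := 1) hc ?_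
            rw [map_add, castHom_natCast_val (p := p) hc, castHom_natCast_val (p := p) hc,
              castHom_natCast_val (p := p) hc]
        _ = S := Fintype.sum_equiv (Equiv.addLeft k₀) _ _ fun j ↦ rfl
    have h0 : (η u - 1) * S = 0 := by linear_combination hfix
    exact (mul_eq_zero.mp h0).resolve_left (sub_ne_zero.mpr hηu)

/-- The same coset sum with a minus sign: `∑_{j mod p} η(y − p^{c−1}·j) = 0`. [folklore] -/
theorem sum_coset_sub_eq_zero (hc : 0 < c) (hη : η.IsPrimitive) (y : ZMod (p ^ c)) :
    ∑ j : ZMod (p ^ 1), η (y - ((p ^ (c - 1) : ℕ) : ZMod (p ^ c)) * ((j.val : ℕ) : ZMod (p ^ c))) = 0 := by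
  haveI : NeZero (p ^ 1) := ⟨pow_ne_zero _ (Fact.out : p.Prime).ne_zero⟩
  rw [← sum_coset_eq_zero η hc hη y]
  refine Fintype.sum_equiv (Equiv.neg (ZMod (p ^ 1))) _ _ fun j ↦ ?_
  rw [Equiv.neg_apply, sub_eq_add_neg, ← mul_neg]
  congr 2
  refine mul_eq_mul_of_castHom_eq (p := p) (n := c) (c := 1) hc ?_
  rw [map_neg, castHom_natCast_val (p := p) hc, castHom_natCast_val (p := p) hc]

end Coset

/-! ### §2 `U_p (f ⊗ η̄) = 0` in the rational plus symbols of `f` -/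

section Fibre

variable {N : ℕ} [NeZero N] (f : CuspForm (Gamma0 N) 2)
variable {c : ℕ} (η : DirichletCharacter ℂ_[p] (p ^ c))

/-- `[r + m/p^c]⁺_f` depends only on `m mod p^c`. [cite: MazurTateTeitelbaum1986Invent, §I.4 (4.2)] -/
theorem ratPlusSymbol_add_natCast_div_pow (r : ℚ) (m : ℕ) :
    ratPlusSymbol f (r + (m : ℚ) / (p : ℚ) ^ c) =
      ratPlusSymbol f (r + (((m : ZMod (p ^ c)).val : ℕ) : ℚ) / (p : ℚ) ^ c) := by
  have hp : (p : ℚ) ^ c ≠ 0 := pow_ne_zero _ (Nat.cast_ne_zero.mpr (Fact.out : p.Prime).ne_zero)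
  rw [ZMod.val_natCast]
  have h : ((m % p ^ c : ℕ) : ℚ) + (p : ℚ) ^ c * ((m / p ^ c : ℕ) : ℚ) = (m : ℚ) := by
    exact_mod_cast Nat.mod_add_div m (p ^ c)
  have hm : r + (m : ℚ) / (p : ℚ) ^ c =
      r + ((m % p ^ c : ℕ) : ℚ) / (p : ℚ) ^ c + (((m / p ^ c : ℕ) : ℤ) : ℚ) := by
    rw [Int.cast_natCast, ← h, add_div, mul_div_cancel_left₀ _ hp, add_assoc]
  rw [hm, ratPlusSymbol_add_intCast_eq]

/-- **The symbol of the fibre sum**: `[(a + pⁿj)/pⁿ⁺¹ + b/p^c]⁺ = [a/pⁿ⁺¹ + y/p^c]⁺` with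
`y = b + p^{c−1}j ∈ ℤ/p^c` (`c ≥ 1`), since `pⁿj/pⁿ⁺¹ = j/p = p^{c−1}j/p^c`.
[cite: MazurTateTeitelbaum1986Invent, §I.4 (4.2)] -/
theorem ratPlusSymbol_fibre_eq (hc : 1 ≤ c) (n a : ℕ) (j : ZMod (p ^ 1)) (b : ZMod (p ^ c)) :
    ratPlusSymbol f (((a + p ^ n * j.val : ℕ) : ℚ) / (p : ℚ) ^ (n + 1) + (b.val : ℚ) / (p : ℚ) ^ c) =
      ratPlusSymbol f ((a : ℚ) / (p : ℚ) ^ (n + 1) +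
        (((b + ((p ^ (c - 1) : ℕ) : ZMod (p ^ c)) * ((j.val : ℕ) : ZMod (p ^ c))).val : ℕ) : ℚ) /
          (p : ℚ) ^ c) := by
  haveI : NeZero (p ^ c) := ⟨pow_ne_zero _ (Fact.out : p.Prime).ne_zero⟩
  have hp0 : (p : ℚ) ≠ 0 := Nat.cast_ne_zero.mpr (Fact.out : p.Prime).ne_zero
  have hsum : ((a + p ^ n * j.val : ℕ) : ℚ) / (p : ℚ) ^ (n + 1) + (b.val : ℚ) / (p : ℚ) ^ c =
      (a : ℚ) / (p : ℚ) ^ (n + 1) + ((b.val + p ^ (c - 1) * j.val : ℕ) : ℚ) / (p : ℚ) ^ c := by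
    have hpc : (p : ℚ) ^ c = (p : ℚ) ^ (c - 1) * p := by
      rw [← pow_succ, Nat.sub_add_cancel hc]
    have hpn : (p : ℚ) ^ (n + 1) = (p : ℚ) ^ n * p := pow_succ _ _
    push_cast
    rw [hpc, hpn]
    field_simp
    ring
  rw [hsum, ratPlusSymbol_add_natCast_div_pow f]
  congr 4
  push_cast
  rw [ZMod.natCast_zmod_val]

/-- **`U_p (f ⊗ η̄) = 0` in symbols.** For `η` PRIMITIVE mod `p^c` (`c ≥ 1`), any cusp form `f` on `Γ₀(N)`,
any `n` and any numerator `a`: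
`∑_{j mod p} ∑_{b mod p^c} η(b) [ (a + pⁿj)/pⁿ⁺¹ + b/p^c ]⁺_f = 0`
— the `η̄`-untwisted symbol sums of `f` at level `pⁿ⁺¹` add up to ZERO over each fibre of
`ℤ/pⁿ⁺¹ → ℤ/pⁿ` (Mazur–Tate–Teitelbaum's distribution relation with `a_p = 0`, i.e. `U_p h = 0` for the
coefficientwise twist `h = f ⊗ η̄`): after `b ↦ b − p^{c−1}j` the `j`-sum is a coset sum of `η`
(`sum_coset_sub_eq_zero`). [cite: MazurTateTeitelbaum1986Invent, §I.4 (4.2) and §I.14 (case p ∣ N)]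
[cite: Bellaiche2021, §6.7.2] -/
theorem untwistedFibreSum_eq_zero (hc : 0 < c) (hη : η.IsPrimitive) (n a : ℕ) :
    ∑ j : ZMod (p ^ 1), ∑ b : ZMod (p ^ c), η b *
      algebraMap ℚ ℂ_[p] (ratPlusSymbol f
        (((a + p ^ n * j.val : ℕ) : ℚ) / (p : ℚ) ^ (n + 1) + (b.val : ℚ) / (p : ℚ) ^ c)) = 0 := by
  haveI : NeZero (p ^ c) := ⟨pow_ne_zero _ (Fact.out : p.Prime).ne_zero⟩
  haveI : NeZero (p ^ 1) := ⟨pow_ne_zero _ (Fact.out : p.Prime).ne_zero⟩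
  set t : ZMod (p ^ c) := ((p ^ (c - 1) : ℕ) : ZMod (p ^ c)) with ht
  set Ψ : ZMod (p ^ c) → ℂ_[p] := fun y ↦
    algebraMap ℚ ℂ_[p] (ratPlusSymbol f ((a : ℚ) / (p : ℚ) ^ (n + 1) + ((y.val : ℕ) : ℚ) / (p : ℚ) ^ c))
    with hΨ
  -- Step 1: rewrite the symbols
  have h1 : ∀ (j : ZMod (p ^ 1)) (b : ZMod (p ^ c)),
      η b * algebraMap ℚ ℂ_[p] (ratPlusSymbol f
        (((a + p ^ n * j.val : ℕ) : ℚ) / (p : ℚ) ^ (n + 1) + (b.val : ℚ) / (p : ℚ) ^ c)) =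
      η b * Ψ (b + t * ((j.val : ℕ) : ZMod (p ^ c))) := by
    intro j b
    rw [ratPlusSymbol_fibre_eq f hc n a j b]
  simp_rw [h1]
  -- Step 2: re-index `b ↦ y = b + t j` and swap
  have h2 : ∀ j : ZMod (p ^ 1),
      ∑ b : ZMod (p ^ c), η b * Ψ (b + t * ((j.val : ℕ) : ZMod (p ^ c))) =
        ∑ y : ZMod (p ^ c), η (y - t * ((j.val : ℕ) : ZMod (p ^ c))) * Ψ y := fun j ↦
    Fintype.sum_equiv (Equiv.addRight (t * ((j.val : ℕ) : ZMod (p ^ c)))) _ _ fun b ↦ by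
      simp only [Equiv.coe_addRight, add_sub_cancel_right]
  simp_rw [h2]
  rw [Finset.sum_comm]
  -- Step 3: the inner `j`-sums are coset sums of `η`
  refine Finset.sum_eq_zero fun y _ ↦ ?_
  rw [← Finset.sum_mul, sum_coset_sub_eq_zero η hc hη y, zero_mul]

end Fibre

end Summit.BirchSwinnertonDyer.BirchSwinnertonDyer.Theorems.PSUntwistDistribution
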